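import Literature.MathematicalPhysics.QuantumFieldTheory.Balaban1983to89.B9SmoothHolderClassP

/-!
# `Balaban1983to89.B9SmoothHolderClassPReadings` — the class axioms `hX ∕ hκX` READ at the print-weighted bond pin (P1′) `bXH := bHZKPG (taxiB U) wX`, and the
# MONOTONICITY that lets every consumer member displayed OUT OF `bHZKT g s 1` be read OUT OF `bHZP g s ∕ bHZKP g s` unchanged

T. Bałaban, *Propagators for lattice gauge theories in a background field*, Commun. Math. Phys. **99** (1985) 389–434
[`Balaban1985BackgroundPropagators`, "B9"]; [4] = T. Bałaban, *Propagators and renormalization transformations for lattice gauge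
theories. II*, Commun. Math. Phys. **96** (1984) 223–250 [`Balaban1984PropagatorsII`].

statement-level skeleton of published theorems with citation tags; proofs where landed; nothing here is a claim about the
Yang–Mills mass gap

THE PRINTED LOCI.  [B9] (3.41)–(3.42) p. 397 (the weighted sup classes), (3.43)–(3.45) p. 398, p. 398 (remark after (3.47)); [4] (2.1) p. 224 («Lʲη ≦ 1»), (2.51)–(2.54) pp. 232–233.

WHY THIS FILE (cell `pub-ymgap`, node N06, seat dag-n06-l g24; repair (A′) of LOCATED-U6, `BH13-UNITS-MEMO.md`).  (i) The re-cut letters of rows 20–21 display the class axiom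
`hX` (*«`bXH` embeds into 𝔠⁽¹⁾»*) and the cost `hκX`; at the CURRENT pin they are `B9SmoothHolderClassTReadings.hasMaj_id_bHZKG_cNorm ∕ bHZKG_κ_le`; THIS FILE gives them at the
print-weighted pin.  (ii) At print's units the print-weighted size DOMINATES the transported size with sup power 1: `loc_{bHZKT g s 1} = (Lʲη)⁻¹sup + pair_s ≤ (Lʲη)⁻¹sup +
(Lʲη)^{s−1}pair_s = loc_{bHZKP g s}` (`(Lʲη)^{s−1} ≥ 1`) — so EVERY member displayed OUT OF `bHZKT (taxiB U) s 1` (the certificate's `h44m h44Ds h45Y` inputs, the ✓ rows of the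
memo) is a member OUT OF `bHZKP (taxiB U) s` with the same majorant: a re-pin to (P1′)(P2′) can keep those displays VERBATIM.
* §1 `bHZKT_loc_le_bHZKP_loc`, `bHZT_loc_le_bHZP_loc` (the domination, at `hcf`); ★ `hasMaj_from_bHZKP_of_bHZKT`, ★ `hasMaj_from_bHZP_of_bHZT` (any `K ≥ 0` member out of the
  transported class with sup power 1 is a member out of the print-weighted class);
* §2 ★★ `hasMaj_id_bHZKP_cNorm` (`hX` at `bHZKP g s`: `L·e^{δr}·e^{−δd}`), ★★ `hasMaj_id_bHZKPG_cNorm` (at the graded pin: `(w s)⁻¹·L·e^{δr}`), `bHZKP_κ_le`, `bHZKPG_κ_le`.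
HONEST SCOPE.  Bookkeeping over landed objects; nothing of [B9]∕[4] asserted; no pin, no certificate edit; COUNT-NEUTRAL; N06 NOT discharged; nothing continuum, nothing about
the mass gap.  Cell `pub-ymgap` (HUMAN RULING D-0062), Track A node N06 [B9], seat `pub-ymgap-dag-n06-l` (g24), 2026-08-29.
-/

noncomputable section

namespace Literature.MathematicalPhysics.QuantumFieldTheory.Balaban1983to89.B9SmoothHolderClassPReadings

open B6GlobalChartV1 (PV blkV1)
open B6Ineq2142KLevelV1 (β lvl)
open B6KLevelCensusIndexV1 (KIdx)
open B6Prop22KLevelTorusCensusEta (nKT)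
open B9GeoNormsKLevelV1 (geo9K)
open B9GeoLemma21KLevelV1 (geo9K_len_pos)
open B9Thm34Ext (toB6)
open B11SectG (BlockNorm HasMaj)
open B11SectGGlobal (Size)
open B11SectGGlobalSizes
open B9Thm312Whole (cNorm)
open B9CoReadingCoords (XBK blkBK)
open B9CoReadingCoordsS (XSK sIK)
open B9MultiscaleSmoothPartitionY (NearY)
open B9MultiscaleSmoothPartitionYLip (CLip)
open B9SmoothHolderClassS (Wscl)
open B9SmoothHolderClassT (bHZT bHZT_loc bHZKT bHZKT_loc)
open B9SmoothHolderClassTClosure (len_le_one len_rpow_neg_eq_Wscl)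
open B9SmoothHolderClassTReadings (hasMaj_id_bHZKT_cNorm)
open B9SmoothHolderClassP (bHZP bHZP_loc_print bHZP_κ bHZKP bHZKP_loc_print bHZKP_κ bHZPG bHZKPG bHZKPG_κ hasMaj_from_bHZKPG)
open Node00 (SiteY FBondY IBondY toKT levY)

variable {d ℓ : ℕ} {hd : 1 ≤ d + 1} {hL : Odd (ℓ + 1) ∧ 1 < ℓ + 1} {b₀ b₁ : ℝ}
variable {𝔸 : Type} [NormedRing 𝔸] [NormedAlgebra ℂ 𝔸]
variable {κ : Type} [Fintype κ]
variable (i : KIdx d ℓ hd hL b₀ b₁) [Fintype (geo9K i).Site] (b : Module.Basis κ ℝ 𝔸) {R : ℝ} {H : Prop}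

/-! ## §1 The print-weighted size dominates the transported size with sup power 1 -/

open Classical in
/-- `loc_{bHZKT g s 1} ≤ loc_{bHZKP g s}`: `(Lʲη)⁻¹sup + pair_s ≤ (Lʲη)⁻¹sup + (Lʲη)^{s−1}pair_s` (`Lʲη ≤ 1`, `s ≤ 1`). [cite: Balaban1984PropagatorsII, (2.1) p.224 («Lʲη ≦ 1»); Balaban1985BackgroundPropagators, (3.43) p.398] -/
theorem bHZKT_loc_le_bHZKP_loc (g : FBondY i → FBondY i → 𝔸ˣ) (hcf : |i.cf| = (nKT (toKT i) : ℝ)) {s : ℝ} (hs0 : 0 ≤ s) (hs1 : s ≤ 1)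
    (y : IBondY i) (F : XBK κ i → ℝ) :
    (bHZKT (κ := κ) i b g (R := R) (H := H) (ε := s) (p := 1) hs0 hs1 hs1).loc y F ≤ (bHZKP (κ := κ) i b g (R := R) (H := H) (s := s) hs0 hs1).loc y F := by
  have hΛ : 0 < (geo9K i).len y := geo9K_len_pos i y
  rw [bHZKP_loc_print i b g hs0 hs1 hcf, bHZKT_loc, ← len_rpow_neg_eq_Wscl i hcf, Real.rpow_neg_one]
  refine add_le_add le_rfl (le_mul_of_one_le_left (Size.nonneg _ _ _) ?_)
  exact Real.one_le_rpow_of_pos_of_le_one_of_nonpos hΛ (len_le_one i hcf y) (by linarith)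

open Classical in
/-- the site twin: `loc_{bHZT g s 1} ≤ loc_{bHZP g s}`. [cite: Balaban1984PropagatorsII, (2.1) p.224; Balaban1985BackgroundPropagators, (3.43) p.398] -/
theorem bHZT_loc_le_bHZP_loc (g : SiteY i → SiteY i → 𝔸ˣ) (hcf : |i.cf| = (nKT (toKT i) : ℝ)) {s : ℝ} (hs0 : 0 ≤ s) (hs1 : s ≤ 1)
    (y : IBondY i) (F : XSK κ i → ℝ) :
    (bHZT (κ := κ) i b g (R := R) (H := H) (ε := s) (p := 1) hs0 hs1 hs1).loc y F ≤ (bHZP (κ := κ) i b g (R := R) (H := H) (s := s) hs0 hs1).loc y F := by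
  have hΛ : 0 < (geo9K i).len y := geo9K_len_pos i y
  rw [bHZP_loc_print i b g hs0 hs1 hcf, bHZT_loc, ← len_rpow_neg_eq_Wscl i hcf, Real.rpow_neg_one]
  refine add_le_add le_rfl (le_mul_of_one_le_left (Size.nonneg _ _ _) ?_)
  exact Real.one_le_rpow_of_pos_of_le_one_of_nonpos hΛ (len_le_one i hcf y) (by linarith)

variable {F₂ : Type} [AddCommGroup F₂] [Module ℝ F₂]

/-- ★ **EVERY MEMBER OUT OF `bHZKT g s 1` IS A MEMBER OUT OF `bHZKP g s`** with the same (non-negative) majorant — the certificate's displayed (3.44)∕(3.45) inputs at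
`bHZKT (taxiB U) s 1` can be kept verbatim at the print-weighted pin. [cite: Balaban1985BackgroundPropagators, (3.44)–(3.45) p.398; Balaban1984PropagatorsII, (2.51) p.232] -/
theorem hasMaj_from_bHZKP_of_bHZKT (g : FBondY i → FBondY i → 𝔸ˣ) (hcf : |i.cf| = (nKT (toKT i) : ℝ)) {s : ℝ} (hs0 : 0 ≤ s) (hs1 : s ≤ 1)
    {b₂ : BlockNorm (toB6 (geo9K i) R H) F₂} {T : (XBK κ i → ℝ) →ₗ[ℝ] F₂} {K : IBondY i → IBondY i → ℝ} (hK : ∀ a c, 0 ≤ K a c)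
    (h : HasMaj (bHZKT (κ := κ) i b g (R := R) (H := H) (ε := s) (p := 1) hs0 hs1 hs1) b₂ T K) :
    HasMaj (bHZKP (κ := κ) i b g (R := R) (H := H) (s := s) hs0 hs1) b₂ T K := fun y' μ hμ y =>
  (h y' μ hμ y).trans (mul_le_mul_of_nonneg_left (bHZKT_loc_le_bHZKP_loc i b g hcf hs0 hs1 y' μ) (hK y y'))

/-- ★ the site twin: every member out of `bHZT g s 1` is a member out of `bHZP g s`. [cite: Balaban1985BackgroundPropagators, (3.44)–(3.45) p.398; Balaban1984PropagatorsII, (2.51) p.232] -/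
theorem hasMaj_from_bHZP_of_bHZT (g : SiteY i → SiteY i → 𝔸ˣ) (hcf : |i.cf| = (nKT (toKT i) : ℝ)) {s : ℝ} (hs0 : 0 ≤ s) (hs1 : s ≤ 1)
    {b₂ : BlockNorm (toB6 (geo9K i) R H) F₂} {T : (XSK κ i → ℝ) →ₗ[ℝ] F₂} {K : IBondY i → IBondY i → ℝ} (hK : ∀ a c, 0 ≤ K a c)
    (h : HasMaj (bHZT (κ := κ) i b g (R := R) (H := H) (ε := s) (p := 1) hs0 hs1 hs1) b₂ T K) :
    HasMaj (bHZP (κ := κ) i b g (R := R) (H := H) (s := s) hs0 hs1) b₂ T K := fun y' μ hμ y =>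
  (h y' μ hμ y).trans (mul_le_mul_of_nonneg_left (bHZT_loc_le_bHZP_loc i b g hcf hs0 hs1 y' μ) (hK y y'))

/-! ## §2 ★★ The class axioms `hX`, `hκX` at the print-weighted bond pin -/

/-- ★★ **THE CLASS AXIOM `hX` AT `bHZKP g s`**: the identity `bHZKP g s → 𝔠⁽¹⁾ = cNorm (blkBK bI) 1` has the majorant `L·e^{δr}·e^{−δd}` for every table `g`, `0 ≤ s ≤ 1`, `δ ≥ 0` (the sup
channel of the print-weighted size IS `(Lʲη)⁻¹·sup`; `B9SmoothHolderClassTReadings.hasMaj_id_bHZKT_cNorm` at `(s, 1)` + §1).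
[cite: Balaban1985BackgroundPropagators, (3.41)–(3.42) p.397 + (3.44) p.398 + p.398 (remark after (3.47)); Balaban1984PropagatorsII, (2.51)–(2.54) p.232] -/
theorem hasMaj_id_bHZKP_cNorm (g : FBondY i → FBondY i → 𝔸ˣ) {s : ℝ} (hs0 : 0 ≤ s) (hs1 : s ≤ 1)
    (hlen : ∀ y : (geo9K i).Site, 0 ≤ (geo9K i).len y) {bI : FBondY i → IBondY i}
    (hlev : ∀ f : FBondY i, lvl i.hN i.D i.hk (bI f) = (blkV1 i.hN i.D f).1.1) (hbI0 : ∀ f : FBondY i, bI f = bI ⟨f.src, 0⟩)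
    {r δ : ℝ} (hδ : 0 ≤ δ) (hN : ∀ (y : IBondY i) (z : SiteY i), NearY i y z → (geo9K i).dist y (sIK i bI z) ≤ r)
    (hcf : |i.cf| = (nKT (toKT i) : ℝ)) :
    HasMaj (bHZKP (κ := κ) i b g (R := R) (H := H) (s := s) hs0 hs1) (cNorm R H (blkBK i bI) hlen 1) LinearMap.id
      (fun y y' => (((ℓ + 1 : ℕ) : ℝ)) * Real.exp (δ * r) * Real.exp (-(δ * (geo9K i).dist y y'))) :=
  hasMaj_from_bHZKP_of_bHZKT i b g hcf hs0 hs1 (fun _ _ => by positivity)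
    (hasMaj_id_bHZKT_cNorm i b g hs0 hs1 hs1 le_rfl hlen hlev hbI0 hδ hN hcf.le)

/-- ★★ **`hX` OUT OF THE GRADED PRINT-WEIGHTED BOND PIN `bHZKPG g w`** at any exponent `0 < s < 1` with `0 < w s`: constant `(w s)⁻¹·L·e^{δr}`.
[cite: Balaban1985BackgroundPropagators, (3.41)–(3.42) p.397 + (3.44)–(3.45) p.398; Balaban1984PropagatorsII, (2.51)–(2.54) p.232] -/
theorem hasMaj_id_bHZKPG_cNorm (g : FBondY i → FBondY i → 𝔸ˣ) (w : ℝ → ℝ) (hw0 : ∀ s, 0 ≤ w s) (hw1 : ∀ s, w s ≤ 1)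
    {s : ℝ} (hs0 : 0 < s) (hs1 : s < 1) (hws : 0 < w s)
    (hlen : ∀ y : (geo9K i).Site, 0 ≤ (geo9K i).len y) {bI : FBondY i → IBondY i}
    (hlev : ∀ f : FBondY i, lvl i.hN i.D i.hk (bI f) = (blkV1 i.hN i.D f).1.1) (hbI0 : ∀ f : FBondY i, bI f = bI ⟨f.src, 0⟩)
    {r δ : ℝ} (hδ : 0 ≤ δ) (hN : ∀ (y : IBondY i) (z : SiteY i), NearY i y z → (geo9K i).dist y (sIK i bI z) ≤ r)
    (hcf : |i.cf| = (nKT (toKT i) : ℝ)) :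
    HasMaj (bHZKPG (κ := κ) i b g (R := R) (H := H) w hw0 hw1) (cNorm R H (blkBK i bI) hlen 1) LinearMap.id
      (fun y y' => (w s)⁻¹ * ((((ℓ + 1 : ℕ) : ℝ)) * Real.exp (δ * r) * Real.exp (-(δ * (geo9K i).dist y y')))) :=
  hasMaj_from_bHZKPG i b g w hw0 hw1 hs0 hs1 hws (fun _ _ => by positivity)
    (hasMaj_id_bHZKP_cNorm i b g hs0.le hs1.le hlen hlev hbI0 hδ hN hcf)

/-- ★ the uniform cutting-cost binder `hκX` at the print-weighted bond class: `κ = 1 + C_Lip`. [cite: Balaban1984PropagatorsII, (2.52) p.232; Balaban1985BackgroundPropagators, (3.43) p.398] -/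
theorem bHZKP_κ_le (g : FBondY i → FBondY i → 𝔸ˣ) {s : ℝ} (hs0 : 0 ≤ s) (hs1 : s ≤ 1) :
    (bHZKP (κ := κ) i b g (R := R) (H := H) (s := s) hs0 hs1).κ ≤ 1 + CLip d ℓ := le_of_eq (bHZKP_κ i b g hs0 hs1)

/-- ★ … and at the graded print-weighted bond pin. [cite: Balaban1984PropagatorsII, (2.52) p.232; Balaban1985BackgroundPropagators, (3.43) p.398] -/
theorem bHZKPG_κ_le (g : FBondY i → FBondY i → 𝔸ˣ) (w : ℝ → ℝ) (hw0 : ∀ s, 0 ≤ w s) (hw1 : ∀ s, w s ≤ 1) :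
    (bHZKPG (κ := κ) i b g (R := R) (H := H) w hw0 hw1).κ ≤ 1 + CLip d ℓ := le_of_eq (bHZKPG_κ i b g w hw0 hw1)

end Literature.MathematicalPhysics.QuantumFieldTheory.Balaban1983to89.B9SmoothHolderClassPReadings

end
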